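import Mathlib
import Summits.ValiantsHypothesis.ValiantsHypothesis.Theses.LiouvilleSarnak
import Summits.ValiantsHypothesis.ValiantsHypothesis.Theorems.LiouvilleSarnakLiouvilleCutRankFourPointParallelogram

/-!
# Route LiouvilleSarnak — crux `LiouvilleCutRank` (stmt-ValiantsHypothesis-14775):
# THE FOUR-POINT ENGINE IN EFFECTIVE FORM, AND SCALE-ROBUST HYPOTHESES

`…FourPointLogChowla.lean` / `…FourPointParallelogram.lean` derive the crux from logarithmically
averaged parallelogram four-point correlations of `λ` along `n ≡ b (mod 4^ℓ)` that are `o(log x)` —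
i.e. small at ALL large scales `x`.  The argument is in fact scale-by-scale, and this file records it
in that form, so that inputs valid only at SOME scales (a subsequence, "almost all scales" in the
sense of Tao–Teräväinen, Algebra Number Theory 13 (2019)) can be fed in:

* ★ `exists_block_distinctRows_of_rectSum_lt` — EFFECTIVE ENGINE: fix a balanced cut word `π₁` of
  `2ℓ` positions, `D` with `3D ≤ 2^ℓ`, and ONE scale `x`.  If the total of the logarithmic
  rectangle sums `Σ_{r≠r', c≠c'} Σ_{H ≤ x} λ(4^ℓH+N(r,c)+1) λ(4^ℓH+N(r',c)+1) λ(4^ℓH+N(r,c')+1)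
  λ(4^ℓH+N(r',c')+1) / H` is `< log (x + 1)`, then SOME aligned block `B_H` with `1 ≤ H ≤ x` has at
  least `D` distinct `π₁`-rows (Gram count: otherwise every `B_H`, `H ≤ x`, has off-diagonal
  four-fold sum `≥ 1`, and `Σ_{H ≤ x} 1/H ≥ log (x + 1)`).
* ★ `liouvilleCutRank_of_frequently_small_parallelogramSums` — SCALE-ROBUST BRIDGE: it suffices
  that for every `ℓ` and `ε > 0` there are ARBITRARILY LARGE scales `x` (`∃ᶠ x`) at which ALL
  parallelogram correlations of level `ℓ` (additive quadruples of pairwise distinct shifts in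
  `[1, 4^ℓ]`) satisfy `|Σ_{n ≤ x} λ(4^ℓn+b₁)λ(4^ℓn+b₂)λ(4^ℓn+b₃)λ(4^ℓn+b₄)/n| ≤ ε log x`.  (An
  "almost all scales" theorem for each fixed pattern gives this, finitely many patterns per level
  having a common good scale.)

Honest framing: bookkeeping around the same open four-point input; `LiouvilleCutRank` stays OPEN,
nothing here bears on VP versus VNP.  No definitions.
-/

-- the directory `ValiantsHypothesis/ValiantsHypothesis` repeats the summit name (tree layout)
set_option linter.dupNamespace false

namespace Summit.ValiantsHypothesis.ValiantsHypothesis.Theorems.LiouvilleSarnakLiouvilleCutRank.FourPointEngine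

open Finset ArithmeticFunction Filter Asymptotics

open Summit.ValiantsHypothesis.ValiantsHypothesis.Theses.LiouvilleSarnak (LiouvilleCutRank)
open Summit.ValiantsHypothesis.ValiantsHypothesis.Theorems.LiouvilleSarnakLiouvilleCutRank.OneBlock
  (liouvilleCutRank_iff_oneBlock_distinctRows)
open Summit.ValiantsHypothesis.ValiantsHypothesis.Theorems.LiouvilleSarnakLiouvilleCutRank.BlockEntropy
  (card_image_blockRows_eq liouville_succ_eq_or)
open Summit.ValiantsHypothesis.ValiantsHypothesis.Theorems.LiouvilleSarnakLiouvilleCutRank.GramCount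
  (card_sq_le_of_image_card_le)
open Summit.ValiantsHypothesis.ValiantsHypothesis.Theorems.LiouvilleSarnakLiouvilleCutRank.FourPoint
  (cutAddress_injective)
open Summit.ValiantsHypothesis.ValiantsHypothesis.Theorems.LiouvilleSarnakLiouvilleCutRank.FourPointParallelogram
  (cutAddress_parallelogram)

/-! ### §1 The effective engine -/

/-- ★ **Effective four-point engine.**  For a balanced cut word `π₁` of `2ℓ` bit positions, `D` with
`3D ≤ 2^ℓ` and a scale `x`: if the total logarithmic rectangle sum at scale `x` is `< log (x + 1)`,
then some aligned `4^ℓ`-block `B_H`, `1 ≤ H ≤ x`, shows at least `D` distinct `π₁`-rows.  Proof: if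
not, the Gram count (`GramCount.card_sq_le_of_image_card_le`, `N = 2^ℓ ≥ 3(D-1)`) makes the
off-diagonal four-fold sum of every `B_H`, `H ≤ x`, at least `1`, so the total is
`≥ Σ_{H ≤ x} 1/H ≥ log (x + 1)`. [folklore] -/
theorem exists_block_distinctRows_of_rectSum_lt (ℓ D : ℕ) (hℓ : 3 * D ≤ 2 ^ ℓ)
    (π₁ : Fin ℓ ⊕ Fin ℓ ≃ Fin (2 * ℓ)) (x : ℕ)
    (hsum : ∑ p ∈ (univ : Finset (Fin ℓ → Bool)).offDiag,
        ∑ q ∈ (univ : Finset (Fin ℓ → Bool)).offDiag, ∑ n ∈ Icc 1 x,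
          ((liouville (2 ^ (2 * ℓ) * n +
              (Nat.ofBits (fun j : Fin (2 * ℓ) => Sum.elim p.1 q.1 (π₁.symm j)) + 1)) : ℝ) *
            (liouville (2 ^ (2 * ℓ) * n +
              (Nat.ofBits (fun j : Fin (2 * ℓ) => Sum.elim p.2 q.1 (π₁.symm j)) + 1)) : ℝ) *
            (liouville (2 ^ (2 * ℓ) * n +
              (Nat.ofBits (fun j : Fin (2 * ℓ) => Sum.elim p.1 q.2 (π₁.symm j)) + 1)) : ℝ) *
            (liouville (2 ^ (2 * ℓ) * n +
              (Nat.ofBits (fun j : Fin (2 * ℓ) => Sum.elim p.2 q.2 (π₁.symm j)) + 1)) : ℝ)) / n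
        < Real.log ↑(x + 1)) :
    ∃ H ∈ Icc 1 x, D ≤ ((univ : Finset (Fin ℓ → Bool)).image fun r : Fin ℓ → Bool =>
      fun c : Fin ℓ → Bool =>
        (((liouville (Nat.ofBits (fun j : Fin (2 * ℓ) => Sum.elim r c (π₁.symm j)) +
          2 ^ (2 * ℓ) * H + 1) : ℤ) : ℂ))).card := by
  classical
  by_contra hcon
  push Not at hcon
  -- notation: addresses and the integer block matrices
  set N : (Fin ℓ → Bool) → (Fin ℓ → Bool) → ℕ := fun r c =>
    Nat.ofBits (fun j : Fin (2 * ℓ) => Sum.elim r c (π₁.symm j)) with hNdef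
  set B : ℕ → (Fin ℓ → Bool) → (Fin ℓ → Bool) → ℤ := fun H r c =>
    (liouville (N r c + 2 ^ (2 * ℓ) * H + 1) : ℤ) with hBdef
  have hB : ∀ H r c, B H r c = 1 ∨ B H r c = -1 := fun H r c => liouville_succ_eq_or _
  -- every block in range has `≤ D - 1` distinct (integer) rows
  have hrows : ∀ H ∈ Icc 1 x, ((univ : Finset (Fin ℓ → Bool)).image (B H)).card ≤ D - 1 := by
    intro H hH
    have h1 := hcon H hH
    rw [card_image_blockRows_eq ℓ H π₁] at h1
    exact Nat.le_sub_one_of_lt h1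
  have hcardN : Fintype.card (Fin ℓ → Bool) = 2 ^ ℓ := by simp
  -- the off-diagonal four-fold sum of every block in range is `≥ 1`
  set OD : ℕ → ℤ := fun H => ∑ p ∈ (univ : Finset (Fin ℓ → Bool)).offDiag,
      ∑ q ∈ (univ : Finset (Fin ℓ → Bool)).offDiag,
        B H p.1 q.1 * B H p.2 q.1 * B H p.1 q.2 * B H p.2 q.2 with hOD
  have hOD1 : ∀ H ∈ Icc 1 x, 1 ≤ OD H := by
    intro H hH
    have hG := card_sq_le_of_image_card_le (B H) (hB H) (D - 1) (hrows H hH)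
    rw [hcardN] at hG
    have hD1 : 1 ≤ D - 1 := by
      have h0 : 0 < ((univ : Finset (Fin ℓ → Bool)).image (B H)).card :=
        card_pos.mpr ⟨B H (fun _ => false), mem_image_of_mem _ (mem_univ _)⟩
      have := hrows H hH
      omega
    set D' : ℕ := D - 1 with hD'
    have hM3 : 3 * D' ≤ 2 ^ ℓ := le_trans (by omega) hℓ
    have hM3' : 3 * (D' : ℤ) ≤ (2 : ℤ) ^ ℓ := by exact_mod_cast hM3
    have hD1' : (1 : ℤ) ≤ (D' : ℤ) := by exact_mod_cast hD1
    have hG' : (((2 ^ ℓ : ℕ) : ℤ) * ((2 ^ ℓ : ℕ) : ℤ)) ^ 2 ≤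
        (D' : ℤ) * OD H + (D' : ℤ) * (((2 ^ ℓ : ℕ) : ℤ) * ((2 ^ ℓ : ℕ) : ℤ) *
          (((2 ^ ℓ : ℕ) : ℤ) + ((2 ^ ℓ : ℕ) : ℤ))) := hG
    push_cast at hG'
    set M : ℤ := (2 : ℤ) ^ ℓ with hM
    have hM1 : (3 : ℤ) ≤ M := by linarith
    have hM3pos : (0 : ℤ) ≤ M * M * M := by positivity
    have h1 : 3 * (D' : ℤ) * (M * M * M) ≤ M * (M * M * M) :=
      mul_le_mul_of_nonneg_right hM3' hM3pos
    have h2 : (27 : ℤ) ≤ M * M * M := by nlinarith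
    have h3 : (D' : ℤ) * 27 ≤ (D' : ℤ) * (M * M * M) :=
      mul_le_mul_of_nonneg_left h2 (by positivity)
    by_contra hlt
    push Not at hlt
    have h4' : (D' : ℤ) * OD H < (D' : ℤ) * 1 := mul_lt_mul_of_pos_left hlt (by linarith)
    nlinarith
  -- the four-fold products as products of four Liouville values in one progression
  have e : ∀ m H : ℕ, m + 2 ^ (2 * ℓ) * H + 1 = 2 ^ (2 * ℓ) * H + (m + 1) := by intros; ring
  have hterm : ∀ (H : ℕ) (p q : (Fin ℓ → Bool) × (Fin ℓ → Bool)),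
      ((B H p.1 q.1 * B H p.2 q.1 * B H p.1 q.2 * B H p.2 q.2 : ℤ) : ℝ) =
        ((liouville (2 ^ (2 * ℓ) * H + (N p.1 q.1 + 1)) : ℝ) *
          (liouville (2 ^ (2 * ℓ) * H + (N p.2 q.1 + 1)) : ℝ) *
          (liouville (2 ^ (2 * ℓ) * H + (N p.1 q.2 + 1)) : ℝ) *
          (liouville (2 ^ (2 * ℓ) * H + (N p.2 q.2 + 1)) : ℝ)) := by
    intro H p q
    simp only [hBdef, e]
    push_cast
    rfl
  have hODr : ∀ n : ℕ, (OD n : ℝ) =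
      ∑ p ∈ (univ : Finset (Fin ℓ → Bool)).offDiag, ∑ q ∈ (univ : Finset (Fin ℓ → Bool)).offDiag,
        ((liouville (2 ^ (2 * ℓ) * n + (N p.1 q.1 + 1)) : ℝ) *
          (liouville (2 ^ (2 * ℓ) * n + (N p.2 q.1 + 1)) : ℝ) *
          (liouville (2 ^ (2 * ℓ) * n + (N p.1 q.2 + 1)) : ℝ) *
          (liouville (2 ^ (2 * ℓ) * n + (N p.2 q.2 + 1)) : ℝ)) := by
    intro n
    simp only [hOD]
    rw [Int.cast_sum]
    refine sum_congr rfl fun p _ => ?_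
    rw [Int.cast_sum]
    exact sum_congr rfl fun q _ => hterm n p q
  have hsumeq : ∑ n ∈ Icc 1 x, (OD n : ℝ) / n =
      ∑ p ∈ (univ : Finset (Fin ℓ → Bool)).offDiag, ∑ q ∈ (univ : Finset (Fin ℓ → Bool)).offDiag,
        ∑ n ∈ Icc 1 x,
          ((liouville (2 ^ (2 * ℓ) * n + (N p.1 q.1 + 1)) : ℝ) *
            (liouville (2 ^ (2 * ℓ) * n + (N p.2 q.1 + 1)) : ℝ) *
            (liouville (2 ^ (2 * ℓ) * n + (N p.1 q.2 + 1)) : ℝ) *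
            (liouville (2 ^ (2 * ℓ) * n + (N p.2 q.2 + 1)) : ℝ)) / n := by
    calc ∑ n ∈ Icc 1 x, (OD n : ℝ) / n
        = ∑ n ∈ Icc 1 x, ∑ p ∈ (univ : Finset (Fin ℓ → Bool)).offDiag,
            ∑ q ∈ (univ : Finset (Fin ℓ → Bool)).offDiag,
              ((liouville (2 ^ (2 * ℓ) * n + (N p.1 q.1 + 1)) : ℝ) *
                (liouville (2 ^ (2 * ℓ) * n + (N p.2 q.1 + 1)) : ℝ) *
                (liouville (2 ^ (2 * ℓ) * n + (N p.1 q.2 + 1)) : ℝ) *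
                (liouville (2 ^ (2 * ℓ) * n + (N p.2 q.2 + 1)) : ℝ)) / n := by
          refine sum_congr rfl fun n _ => ?_
          rw [hODr n, sum_div]
          refine sum_congr rfl fun p _ => ?_
          rw [sum_div]
      _ = _ := by
          rw [sum_comm]
          exact sum_congr rfl fun p _ => sum_comm
  -- lower bound: `Σ_{H ≤ x} OD_H / H ≥ Σ_{H ≤ x} 1/H ≥ log (x + 1)`
  have hlow : Real.log ↑(x + 1) ≤ ∑ n ∈ Icc 1 x, (OD n : ℝ) / n := by
    have h2 : Real.log ↑(x + 1) ≤ (harmonic x : ℝ) := log_add_one_le_harmonic x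
    have h3 : (harmonic x : ℝ) = ∑ n ∈ Icc 1 x, (1 : ℝ) / n := by
      rw [harmonic_eq_sum_Icc]; push_cast
      refine sum_congr rfl fun n _ => by rw [one_div]
    have h4 : ∑ n ∈ Icc 1 x, (1 : ℝ) / n ≤ ∑ n ∈ Icc 1 x, (OD n : ℝ) / n := by
      refine sum_le_sum fun n hn => ?_
      have hn1 : (1 : ℝ) ≤ (OD n : ℝ) := by exact_mod_cast hOD1 n hn
      exact div_le_div_of_nonneg_right hn1 (by positivity)
    linarith
  rw [hsumeq] at hlow
  exact absurd (lt_of_le_of_lt hlow hsum) (lt_irrefl _)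

/-! ### §2 A scale-robust bridge -/

/-- ★ **Scale-robust four-point bridge.**  Suppose that for every `ℓ` and every `ε > 0` there are
arbitrarily large scales `x` at which, SIMULTANEOUSLY for all additive quadruples `b₁ + b₄ = b₂ + b₃`
of pairwise distinct shifts in `[1, 4^ℓ]`,
`|Σ_{1 ≤ n ≤ x} λ(4^ℓn+b₁) λ(4^ℓn+b₂) λ(4^ℓn+b₃) λ(4^ℓn+b₄) / n| ≤ ε log x`.  Then `LiouvilleCutRank`
holds.  (Weaker than the `o(log x)` hypothesis of `…FourPointParallelogram.lean`, which gives this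
eventually in `x`; an "almost all scales" statement per pattern also gives it.)  Proof: one-block
criterion + the engine at a good scale with `ε = 1/(2·16^ℓ)`. [folklore] -/
theorem liouvilleCutRank_of_frequently_small_parallelogramSums
    (h : ∀ ℓ : ℕ, ∀ ε : ℝ, 0 < ε → ∃ᶠ x : ℕ in atTop, ∀ b₁ b₂ b₃ b₄ : ℕ, b₁ + b₄ = b₂ + b₃ →
      b₁ ≠ b₂ → b₁ ≠ b₃ → b₁ ≠ b₄ → b₂ ≠ b₃ → b₂ ≠ b₄ → b₃ ≠ b₄ →
      1 ≤ b₁ → 1 ≤ b₂ → 1 ≤ b₃ → 1 ≤ b₄ →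
      b₁ ≤ 2 ^ (2 * ℓ) → b₂ ≤ 2 ^ (2 * ℓ) → b₃ ≤ 2 ^ (2 * ℓ) → b₄ ≤ 2 ^ (2 * ℓ) →
      |∑ n ∈ Icc 1 x,
        ((liouville (2 ^ (2 * ℓ) * n + b₁) : ℝ) * (liouville (2 ^ (2 * ℓ) * n + b₂) : ℝ) *
          (liouville (2 ^ (2 * ℓ) * n + b₃) : ℝ) * (liouville (2 ^ (2 * ℓ) * n + b₄) : ℝ)) / n|
        ≤ ε * Real.log x) :
    LiouvilleCutRank := by
  classical
  rw [liouvilleCutRank_iff_oneBlock_distinctRows]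
  intro D
  obtain ⟨ℓ, hℓ⟩ : ∃ ℓ : ℕ, 3 * D ≤ 2 ^ ℓ := ⟨3 * D, Nat.lt_two_pow_self.le⟩
  refine ⟨ℓ, fun π₁ => ?_⟩
  set N : (Fin ℓ → Bool) → (Fin ℓ → Bool) → ℕ := fun r c =>
    Nat.ofBits (fun j : Fin (2 * ℓ) => Sum.elim r c (π₁.symm j)) with hNdef
  have hNinj : ∀ r r' c c', N r c = N r' c' → r = r' ∧ c = c' :=
    fun r r' c c' h => cutAddress_injective ℓ π₁ r r' c c' h
  have hNle : ∀ r c, N r c + 1 ≤ 2 ^ (2 * ℓ) := fun r c => Nat.ofBits_lt_two_pow _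
  have hNpar : ∀ r r' c c', N r c + N r' c' = N r' c + N r c' :=
    fun r r' c c' => cutAddress_parallelogram ℓ π₁ r r' c c'
  -- a good scale
  set ε : ℝ := 1 / (2 * (16 : ℝ) ^ ℓ) with hε
  have hεpos : 0 < ε := by positivity
  obtain ⟨x, hx, hx2⟩ := ((h ℓ ε hεpos).and_eventually (eventually_ge_atTop 2)).exists
  have hlogpos : 0 < Real.log x := Real.log_pos (by exact_mod_cast hx2)
  -- the total rectangle sum at scale `x` is `≤ (4^ℓ)² ε log x < log x ≤ log (x + 1)`
  have hcard : ((univ : Finset (Fin ℓ → Bool)).offDiag).card ≤ 4 ^ ℓ := by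
    rw [offDiag_card, card_univ, Fintype.card_fun, Fintype.card_bool, Fintype.card_fin]
    calc 2 ^ ℓ * 2 ^ ℓ - 2 ^ ℓ ≤ 2 ^ ℓ * 2 ^ ℓ := Nat.sub_le _ _
      _ = 4 ^ ℓ := by rw [← mul_pow]; norm_num
  obtain ⟨H, -, hH⟩ := exists_block_distinctRows_of_rectSum_lt ℓ D hℓ π₁ x (by
    have hb : ∀ p ∈ (univ : Finset (Fin ℓ → Bool)).offDiag,
        ∀ q ∈ (univ : Finset (Fin ℓ → Bool)).offDiag,
        ∑ n ∈ Icc 1 x,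
          ((liouville (2 ^ (2 * ℓ) * n + (N p.1 q.1 + 1)) : ℝ) *
            (liouville (2 ^ (2 * ℓ) * n + (N p.2 q.1 + 1)) : ℝ) *
            (liouville (2 ^ (2 * ℓ) * n + (N p.1 q.2 + 1)) : ℝ) *
            (liouville (2 ^ (2 * ℓ) * n + (N p.2 q.2 + 1)) : ℝ)) / n ≤ ε * Real.log x := by
      intro p hp q hq
      have hpne : p.1 ≠ p.2 := (mem_offDiag.mp hp).2.2
      have hqne : q.1 ≠ q.2 := (mem_offDiag.mp hq).2.2
      refine le_trans (le_abs_self _) (hx (N p.1 q.1 + 1) (N p.2 q.1 + 1) (N p.1 q.2 + 1)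
        (N p.2 q.2 + 1) (by have := hNpar p.1 p.2 q.1 q.2; omega)
        ?_ ?_ ?_ ?_ ?_ ?_ (by omega) (by omega) (by omega) (by omega)
        (hNle _ _) (hNle _ _) (hNle _ _) (hNle _ _))
      · exact fun h => hpne (hNinj _ _ _ _ (Nat.succ_injective h)).1
      · exact fun h => hqne (hNinj _ _ _ _ (Nat.succ_injective h)).2
      · exact fun h => hpne (hNinj _ _ _ _ (Nat.succ_injective h)).1
      · exact fun h => hpne (hNinj _ _ _ _ (Nat.succ_injective h)).1.symm
      · exact fun h => hqne (hNinj _ _ _ _ (Nat.succ_injective h)).2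
      · exact fun h => hpne (hNinj _ _ _ _ (Nat.succ_injective h)).1
    have htot := sum_le_sum fun p hp => sum_le_sum fun q hq => hb p hp q hq
    refine lt_of_le_of_lt htot ?_
    rw [sum_const, sum_const, smul_smul, nsmul_eq_mul]
    have hc : ((((univ : Finset (Fin ℓ → Bool)).offDiag).card *
        ((univ : Finset (Fin ℓ → Bool)).offDiag).card : ℕ) : ℝ) ≤ (4 : ℝ) ^ ℓ * (4 : ℝ) ^ ℓ := by
      have := Nat.mul_le_mul hcard hcard
      exact_mod_cast this
    have h16 : (4 : ℝ) ^ ℓ * (4 : ℝ) ^ ℓ * ε = 1 / 2 := by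
      rw [hε, ← mul_pow]; norm_num
    have hlog1 : Real.log x ≤ Real.log ↑(x + 1) :=
      Real.log_le_log (by positivity) (by exact_mod_cast Nat.le_succ x)
    nlinarith [mul_le_mul_of_nonneg_right hc (mul_nonneg hεpos.le hlogpos.le)])
  exact ⟨H, hH⟩

end Summit.ValiantsHypothesis.ValiantsHypothesis.Theorems.LiouvilleSarnakLiouvilleCutRank.FourPointEngine
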